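import Literature.MathematicalPhysics.KineticTheory.ConfinedDuality
import Literature.MathematicalPhysics.KineticTheory.ConfinedDynkin
import Mathlib.Probability.Kernel.MeasurableIntegral
import HarnessLib

/-!
# Additive-noise SDEs with a confined drift: the backward Dynkin identity for pair observables

Trunk T-KINETIC (Literature/MathematicalPhysics/KineticTheory); two small definitions and theorems,
no named facts. Let `P_t = sdeKernel Y v₁ v₂ t` be the transition kernels of
`dz = Y dt + v₁ dB¹ + v₂ dB²` for a confined drift `Y` of constant divergence `d` whose reversal
`Y' = -Y` is a REGULAR confined drift (so that the reversed kernels `P̂_t` satisfy Dynkin's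
identity, `ConfinedDynkin.lean`), and let `μ` be an additive Haar measure. For a PAIR OBSERVABLE
`K(x, y)` (continuous, compactly supported on `E × E`) put

  `pairAct K t = ∫ μ(dx) ∫ P_t(x, dy) K(x, y)`

(the pairing of `K` with the measure `μ(dx) P_t(x, dy)`; for `K = ψ ⊗ g` this is `∫ (P_t g) ψ dμ`).
The **backward Dynkin identity**: for `H ∈ C²_c(E × E)` and `t > 0`,

  `pairAct H t = e^{-dt} ( ∫ H(x, x) μ(dx) + ∫₀ᵗ e^{ds} pairAct (L̂₁ H) s ds )`,

where `L̂₁ H (x, y) = L̂[H(·, y)](x)` is the generator of the REVERSED drift acting on the first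
variable (`ConfinedDrift.pairAct_eq_of_contDiff`); hence `t ↦ pairAct H t` is differentiable on
`(0, ∞)` with

  `d/dt pairAct H t = pairAct (L̂₁ H - d H) t = pairAct (Lᵀ₁ H) t`      (`Lᵀ = L̂ - d` is the
                                                                         formal transpose of `L`)

(`ConfinedDrift.hasDerivAt_pairAct`) — the Kolmogorov BACKWARD equation `∂_t P_t = L P_t` in the
weak form "differentiate `∫ (P_t g) ψ dμ` in `t` by moving `L` onto `ψ`", valid for merely bounded
measurable `g`. It is obtained from the DUALITY `μ(dx) P_t(x, dy) = e^{-dt} μ(dy) P̂_t(y, dx)`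
(`ConfinedDuality.lean`) and Dynkin's identity for `P̂` (the FORWARD equation of the reversed
process), with no domain/core considerations for the generator. Also: continuity of
`t ↦ pairAct K t` (`continuous_pairAct`) and the elementary bounds used downstream.

## References

* U. G. Haussmann, É. Pardoux, *Time reversal of diffusions*, Ann. Probab. 14 (1986) 1188–1205.
* D. W. Stroock, S. R. S. Varadhan, *Multidimensional Diffusion Processes* (1979), §3.1
  (backward equation). [folklore]
-/

noncomputable section

open MeasureTheory ProbabilityTheory Filter Topology Set Function
open scoped NNReal ENNReal

namespace Literature.MathematicalPhysics.KineticTheory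

open Literature.Probability.Process Literature.Analysis.ODE

variable {E : Type*} [NormedAddCommGroup E] [NormedSpace ℝ E]

/-! ### Pair observables: compact support in the first variable, the first-variable generator -/

section Pair

omit [NormedSpace ℝ E] in
/-- A compactly supported function on `E × E` vanishes off `K₁ × E` for a compact `K₁`. [folklore] -/
theorem exists_compact_fst_of_hasCompactSupport {K : E × E → ℝ} (hKc : HasCompactSupport K) :
    ∃ K₁ : Set E, IsCompact K₁ ∧ ∀ x, x ∉ K₁ → ∀ y, K (x, y) = 0 :=
  ⟨Prod.fst '' tsupport K, hKc.image continuous_fst, fun x hx y =>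
    image_eq_zero_of_notMem_tsupport fun h => hx ⟨(x, y), h, rfl⟩⟩

omit [NormedSpace ℝ E] in
/-- A continuous compactly supported function on `E × E` is bounded (by a nonnegative constant).
[folklore] -/
theorem exists_bound_of_hasCompactSupport_pair {K : E × E → ℝ} (hK : Continuous K)
    (hKc : HasCompactSupport K) : ∃ C, 0 ≤ C ∧ ∀ p, |K p| ≤ C := by
  obtain ⟨C, hC⟩ := hK.bounded_above_of_compact_support hKc
  exact ⟨max C 0, le_max_right _ _, fun p => (Real.norm_eq_abs _ ▸ hC p).trans (le_max_left _ _)⟩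

variable (Y' : E → E) (v₁ v₂ : E)

/-- The **generator of the reversed drift acting on the first variable** of a pair observable:
`L̂₁ H (x, y) = L̂[H(·, y)](x)`, `L̂ = sdeGenerator Y' v₁ v₂`. [folklore] -/
def sdeGeneratorFst (H : E × E → ℝ) (p : E × E) : ℝ :=
  sdeGenerator Y' v₁ v₂ (fun x => H (x, p.2)) p.1

/-- Unfolding `sdeGeneratorFst`. [folklore] -/
theorem sdeGeneratorFst_apply (H : E × E → ℝ) (x y : E) :
    sdeGeneratorFst Y' v₁ v₂ H (x, y) = sdeGenerator Y' v₁ v₂ (fun x' => H (x', y)) x := rfl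

variable {Y' v₁ v₂}

/-- `D_x[H(·,y)](x)·w = DH(x,y)·(w,0)`. [folklore] -/
theorem fderiv_fstSlice_apply {H : E × E → ℝ} (hH : Differentiable ℝ H) (x y w : E) :
    fderiv ℝ (fun x' => H (x', y)) x w = fderiv ℝ H (x, y) (w, 0) := by
  have h1 : HasFDerivAt (fun x' : E => ((x', y) : E × E))
      ((ContinuousLinearMap.id ℝ E).prod (0 : E →L[ℝ] E)) x :=
    (hasFDerivAt_id x).prodMk (hasFDerivAt_const y x)
  have h2 : HasFDerivAt (fun x' : E => H (x', y))
      ((fderiv ℝ H (x, y)).comp ((ContinuousLinearMap.id ℝ E).prod (0 : E →L[ℝ] E))) x :=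
    (hH (x, y)).hasFDerivAt.comp x h1
  rw [h2.fderiv]
  simp

/-- `D²_x[H(·,y)](x)[v,w] = D[q ↦ DH(q)·(w,0)](x,y)·(v,0)` for `H ∈ C²`. [folklore] -/
theorem fderiv_fderiv_fstSlice_apply {H : E × E → ℝ} (hH : ContDiff ℝ 2 H) (x y v w : E) :
    fderiv ℝ (fderiv ℝ (fun x' => H (x', y))) x v w =
      fderiv ℝ (fun q : E × E => fderiv ℝ H q (w, 0)) (x, y) (v, 0) := by
  have hd : Differentiable ℝ H := hH.differentiable (by norm_num)
  have hfy : ContDiff ℝ 2 (fun x' => H (x', y)) := hH.comp (contDiff_id.prodMk contDiff_const)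
  have hdfy : Differentiable ℝ (fderiv ℝ (fun x' => H (x', y))) :=
    (hfy.fderiv_right (m := 1) (by norm_num)).differentiable one_ne_zero
  have h1 : fderiv ℝ (fun x' => fderiv ℝ (fun x'' => H (x'', y)) x' w) x v =
      fderiv ℝ (fderiv ℝ (fun x' => H (x', y))) x v w := by
    rw [fderiv_clm_apply (hdfy x) (differentiableAt_const w)]
    simp
  have h2 : (fun x' => fderiv ℝ (fun x'' => H (x'', y)) x' w) =
      fun x' => (fun q : E × E => fderiv ℝ H q (w, 0)) (x', y) :=
    funext fun x' => fderiv_fstSlice_apply hd x' y w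
  have hA : Differentiable ℝ (fun q : E × E => fderiv ℝ H q (w, 0)) :=
    ((hH.fderiv_right (m := 1) (by norm_num)).clm_apply contDiff_const).differentiable one_ne_zero
  rw [← h1, h2, fderiv_fstSlice_apply hA x y v]

/-- **`L̂₁ H` through the derivatives of `H` on `E × E`**:
`L̂₁ H (x,y) = DH(x,y)·(Y'x, 0) + ½ ∑_b D[q ↦ DH(q)·(v_b,0)](x,y)·(v_b,0)`. [folklore] -/
theorem sdeGeneratorFst_eq {H : E × E → ℝ} (hH : ContDiff ℝ 2 H) (p : E × E) :
    sdeGeneratorFst Y' v₁ v₂ H p =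
      fderiv ℝ H p (Y' p.1, 0) +
        (1 / 2) * (fderiv ℝ (fun q : E × E => fderiv ℝ H q (v₁, 0)) p (v₁, 0) +
          fderiv ℝ (fun q : E × E => fderiv ℝ H q (v₂, 0)) p (v₂, 0)) := by
  rcases p with ⟨x, y⟩
  rw [sdeGeneratorFst_apply, sdeGenerator_def, fderiv_fstSlice_apply (hH.differentiable (by norm_num)),
    fderiv_fderiv_fstSlice_apply hH, fderiv_fderiv_fstSlice_apply hH]

/-- `L̂₁ H` is continuous for `H ∈ C²` and continuous `Y'`. [folklore] -/
theorem continuous_sdeGeneratorFst (hY' : Continuous Y') {H : E × E → ℝ} (hH : ContDiff ℝ 2 H) :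
    Continuous (sdeGeneratorFst Y' v₁ v₂ H) := by
  have h1 : Continuous (fderiv ℝ H) := hH.continuous_fderiv (by norm_num)
  have h2 : ∀ w : E, Continuous (fderiv ℝ (fun q : E × E => fderiv ℝ H q (w, 0))) := fun w =>
    ((hH.fderiv_right (m := 1) (by norm_num)).clm_apply contDiff_const).continuous_fderiv one_ne_zero
  have heq : sdeGeneratorFst Y' v₁ v₂ H = fun p =>
      fderiv ℝ H p (Y' p.1, 0) +
        (1 / 2) * (fderiv ℝ (fun q : E × E => fderiv ℝ H q (v₁, 0)) p (v₁, 0) +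
          fderiv ℝ (fun q : E × E => fderiv ℝ H q (v₂, 0)) p (v₂, 0)) :=
    funext fun p => sdeGeneratorFst_eq hH p
  rw [heq]
  exact (h1.clm_apply ((hY'.comp continuous_fst).prodMk continuous_const)).add
    (continuous_const.mul (((h2 v₁).clm_apply continuous_const).add ((h2 v₂).clm_apply continuous_const)))

/-- `L̂₁ H` vanishes off the topological support of `H`. [folklore] -/
theorem sdeGeneratorFst_eq_zero_of_notMem {H : E × E → ℝ} {p : E × E} (hp : p ∉ tsupport H) :
    sdeGeneratorFst Y' v₁ v₂ H p = 0 := by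
  rcases p with ⟨x, y⟩
  rw [sdeGeneratorFst_apply]
  refine sdeGenerator_eq_zero_of_notMem_tsupport v₁ v₂ fun hx => hp ?_
  -- `x ∈ tsupport H(·, y)` forces `(x, y) ∈ tsupport H`
  have hsub : tsupport (fun x' => H (x', y)) ⊆ (fun x' => (x', y)) ⁻¹' tsupport H := by
    refine closure_minimal (fun x' hx' => subset_tsupport _ hx') ?_
    exact (isClosed_tsupport H).preimage (Continuous.prodMk_left y)
  exact hsub hx

/-- `L̂₁ H` has compact support if `H` has. [folklore] -/
theorem hasCompactSupport_sdeGeneratorFst {H : E × E → ℝ} (hHc : HasCompactSupport H) :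
    HasCompactSupport (sdeGeneratorFst Y' v₁ v₂ H) :=
  hHc.mono' fun _ hp => by_contra fun h => hp (sdeGeneratorFst_eq_zero_of_notMem h)

/-- Slices `x ↦ H(x, y)` of `H ∈ C²` are `C²`. [folklore] -/
theorem contDiff_fstSlice {H : E × E → ℝ} {n : WithTop ℕ∞} (hH : ContDiff ℝ n H) (y : E) :
    ContDiff ℝ n fun x => H (x, y) :=
  hH.comp (contDiff_id.prodMk contDiff_const)

omit [NormedSpace ℝ E] in
/-- Slices `x ↦ H(x, y)` of a compactly supported `H` are compactly supported. [folklore] -/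
theorem hasCompactSupport_fstSlice {H : E × E → ℝ} (hHc : HasCompactSupport H) (y : E) :
    HasCompactSupport fun x => H (x, y) := by
  refine HasCompactSupport.intro (hHc.image continuous_fst) fun x hx => ?_
  exact image_eq_zero_of_notMem_tsupport fun hmem => hx ⟨(x, y), hmem, rfl⟩

omit [NormedSpace ℝ E] in
/-- The diagonal `x ↦ H(x, x)` of a compactly supported `H` is compactly supported. [folklore] -/
theorem hasCompactSupport_diag {H : E × E → ℝ} (hHc : HasCompactSupport H) :
    HasCompactSupport fun x => H (x, x) := by
  refine HasCompactSupport.intro (hHc.image continuous_fst) fun x hx => ?_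
  exact image_eq_zero_of_notMem_tsupport fun hmem => hx ⟨(x, x), hmem, rfl⟩

omit [NormedSpace ℝ E] in
/-- The standard data of a continuous compactly supported pair observable: a compact `K₁` off
which (in the first variable) it vanishes, and a bound. [folklore] -/
theorem exists_data_of_hasCompactSupport {K : E × E → ℝ} (hK : Continuous K)
    (hKc : HasCompactSupport K) :
    ∃ (K₁ : Set E) (C : ℝ), IsCompact K₁ ∧ (∀ x, x ∉ K₁ → ∀ y, K (x, y) = 0) ∧ 0 ≤ C ∧
      ∀ p, |K p| ≤ C := by
  obtain ⟨K₁, hK₁, hKK₁⟩ := exists_compact_fst_of_hasCompactSupport hKc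
  obtain ⟨C, hC0, hC⟩ := exists_bound_of_hasCompactSupport_pair hK hKc
  exact ⟨K₁, C, hK₁, hKK₁, hC0, hC⟩

end Pair

/-! ### The pair action of the transition kernels -/

section PairAct

variable [CompleteSpace E] [MeasurableSpace E]

/-- The **pair action** `pairAct K t = ∫ μ(dx) ∫ P_t(x, dy) K(x, y)` of the transition kernels
`P_t = sdeKernel Y v₁ v₂ t` on a pair observable `K`, with respect to the reference measure `μ`.
[folklore] -/
def pairAct (Y : E → E) (v₁ v₂ : E) (μ : Measure E) (K : E × E → ℝ) (t : ℝ≥0) : ℝ :=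
  ∫ x, ∫ y, K (x, y) ∂(sdeKernel Y v₁ v₂ t x) ∂μ

/-- Unfolding `pairAct`. [folklore] -/
theorem pairAct_def (Y : E → E) (v₁ v₂ : E) (μ : Measure E) (K : E × E → ℝ) (t : ℝ≥0) :
    pairAct Y v₁ v₂ μ K t = ∫ x, ∫ y, K (x, y) ∂(sdeKernel Y v₁ v₂ t x) ∂μ := rfl

end PairAct

namespace ConfinedDrift

variable [FiniteDimensional ℝ E] [CompleteSpace E] [MeasurableSpace E] [BorelSpace E]
  [SecondCountableTopology E] {Y : E → E} (D : ConfinedDrift Y) {v₁ v₂ : E}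
  (hv₁ : v₁ ∈ D.noise) (hv₂ : v₂ ∈ D.noise) (μ : Measure E) [μ.IsAddHaarMeasure]
include D hv₁ hv₂

/-! ### The pair action through the solution map; bounds, linearity, continuity -/

/-- The inner integral through the solution map: `∫ K(x, y) P_t(x, dy) = E K(x, Φ_t(x, B))`.
[folklore] -/
theorem integral_sdeKernel_pair {K : E × E → ℝ} (hK : Continuous K) (t : ℝ≥0) (x : E) :
    ∫ y, K (x, y) ∂(sdeKernel Y v₁ v₂ t x) =
      ∫ ω, K (x, sdeSolMap Y v₁ v₂ t x (pairPath ω)) ∂wienerPair :=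
  D.integral_sdeKernel hv₁ hv₂ t x (hK.comp (Continuous.prodMk_right x)).aestronglyMeasurable

/-- The integrand `(x, ω) ↦ K(x, Φ_t(x, B(ω)))` is jointly measurable. [folklore] -/
theorem measurable_pair_sdeSolMap {K : E × E → ℝ} (hK : Continuous K) (t : ℝ) :
    Measurable fun p : E × WienerPair => K (p.1, sdeSolMap Y v₁ v₂ t p.1 (pairPath p.2)) :=
  hK.measurable.comp (measurable_fst.prodMk (D.measurable_sdeSolMap_pairPath hv₁ hv₂ t))

/-- **The pair action as ONE integral over `μ ⊗ Wiener`**: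
`pairAct K t = ∫ K(x, Φ_t(x, B(ω))) d(μ ⊗ P)(x, ω)`, for continuous `K` bounded by `C` and
vanishing off `K₁ × E`, `K₁` compact (an integrable majorant `C 1_{K₁}`). [folklore] -/
theorem pairAct_eq_integral_prod {K : E × E → ℝ} (hK : Continuous K) {K₁ : Set E} (hK₁ : IsCompact K₁)
    (hKK₁ : ∀ x, x ∉ K₁ → ∀ y, K (x, y) = 0) {C : ℝ} (hC : ∀ p, |K p| ≤ C) (t : ℝ≥0) :
    Integrable (fun p : E × WienerPair => K (p.1, sdeSolMap Y v₁ v₂ t p.1 (pairPath p.2)))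
        (μ.prod wienerPair) ∧
      pairAct Y v₁ v₂ μ K t =
        ∫ p, K (p.1, sdeSolMap Y v₁ v₂ t p.1 (pairPath p.2)) ∂(μ.prod wienerPair) := by
  have hmeas := D.measurable_pair_sdeSolMap hv₁ hv₂ hK t
  -- the majorant `C 1_{K₁ × univ}`
  have hfin : (μ.prod wienerPair) (K₁ ×ˢ (univ : Set WienerPair)) < ⊤ := by
    rw [Measure.prod_prod, measure_univ, mul_one]
    exact hK₁.measure_lt_top
  have hdom : Integrable ((K₁ ×ˢ (univ : Set WienerPair)).indicator fun _ => C) (μ.prod wienerPair) :=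
    (integrableOn_const hfin.ne).integrable_indicator (hK₁.measurableSet.prod MeasurableSet.univ)
  have hint : Integrable (fun p : E × WienerPair => K (p.1, sdeSolMap Y v₁ v₂ t p.1 (pairPath p.2)))
      (μ.prod wienerPair) := by
    refine hdom.mono' hmeas.aestronglyMeasurable (Eventually.of_forall fun p => ?_)
    by_cases hp : p.1 ∈ K₁
    · rw [indicator_of_mem (show p ∈ K₁ ×ˢ (univ : Set WienerPair) from ⟨hp, mem_univ _⟩),
        Real.norm_eq_abs]
      exact hC _
    · have hnot : p ∉ K₁ ×ˢ (univ : Set WienerPair) := fun h => hp h.1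
      rw [hKK₁ _ hp, norm_zero, indicator_of_notMem hnot]
  refine ⟨hint, ?_⟩
  rw [pairAct_def, integral_prod _ hint]
  refine integral_congr_ae (Eventually.of_forall fun x => ?_)
  exact D.integral_sdeKernel_pair hv₁ hv₂ hK t x

omit [NormedSpace ℝ E] [FiniteDimensional ℝ E] [CompleteSpace E] [SecondCountableTopology E] D hv₁ hv₂ in
/-- The majorant `C 1_{K₁ × univ}` is integrable on `μ ⊗ Wiener` and its integral is `C μ(K₁)`.
[folklore] -/
theorem integrable_majorant {K₁ : Set E} (hK₁ : IsCompact K₁) (C : ℝ) :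
    Integrable ((K₁ ×ˢ (univ : Set WienerPair)).indicator fun _ => C) (μ.prod wienerPair) ∧
      ∫ p, (K₁ ×ˢ (univ : Set WienerPair)).indicator (fun _ => C) p ∂(μ.prod wienerPair) =
        C * μ.real K₁ := by
  have hfin : (μ.prod wienerPair) (K₁ ×ˢ (univ : Set WienerPair)) < ⊤ := by
    rw [Measure.prod_prod, measure_univ, mul_one]
    exact hK₁.measure_lt_top
  refine ⟨(integrableOn_const hfin.ne).integrable_indicator (hK₁.measurableSet.prod MeasurableSet.univ), ?_⟩
  rw [integral_indicator_const _ (hK₁.measurableSet.prod MeasurableSet.univ), smul_eq_mul, mul_comm,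
    measureReal_def, Measure.prod_prod, measure_univ, mul_one, ← measureReal_def]

omit [FiniteDimensional ℝ E] [MeasurableSpace E] [BorelSpace E] [SecondCountableTopology E] D hv₁ hv₂ in
/-- The pointwise majorant: `|K(x, Φ_t(x, B))| ≤ C 1_{K₁}(x)`. [folklore] -/
theorem norm_pair_sdeSolMap_le {K : E × E → ℝ} {K₁ : Set E} (hKK₁ : ∀ x, x ∉ K₁ → ∀ y, K (x, y) = 0)
    {C : ℝ} (hC : ∀ p, |K p| ≤ C) (t : ℝ) (p : E × WienerPair) :
    ‖K (p.1, sdeSolMap Y v₁ v₂ t p.1 (pairPath p.2))‖ ≤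
      (K₁ ×ˢ (univ : Set WienerPair)).indicator (fun _ => C) p := by
  by_cases hp : p.1 ∈ K₁
  · rw [indicator_of_mem (show p ∈ K₁ ×ˢ (univ : Set WienerPair) from ⟨hp, mem_univ _⟩),
      Real.norm_eq_abs]
    exact hC _
  · have hnot : p ∉ K₁ ×ˢ (univ : Set WienerPair) := fun h => hp h.1
    rw [hKK₁ _ hp, norm_zero, indicator_of_notMem hnot]

/-- **A bound of the pair action**: `|pairAct K t| ≤ C μ(K₁)` if `|K| ≤ C` vanishes off `K₁ × E`.
[folklore] -/
theorem abs_pairAct_le {K : E × E → ℝ} (hK : Continuous K) {K₁ : Set E} (hK₁ : IsCompact K₁)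
    (hKK₁ : ∀ x, x ∉ K₁ → ∀ y, K (x, y) = 0) {C : ℝ} (hC : ∀ p, |K p| ≤ C) (t : ℝ≥0) :
    |pairAct Y v₁ v₂ μ K t| ≤ C * μ.real K₁ := by
  obtain ⟨-, heq⟩ := D.pairAct_eq_integral_prod hv₁ hv₂ μ hK hK₁ hKK₁ hC t
  obtain ⟨hdom, hint⟩ := integrable_majorant μ hK₁ C
  rw [heq, ← Real.norm_eq_abs, ← hint]
  exact norm_integral_le_of_norm_le hdom (Eventually.of_forall fun p =>
    norm_pair_sdeSolMap_le hKK₁ hC t p)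

/-- The pair action is additive in the observable. [folklore] -/
theorem pairAct_add {K K' : E × E → ℝ} (hK : Continuous K) (hKc : HasCompactSupport K)
    (hK' : Continuous K') (hKc' : HasCompactSupport K') (t : ℝ≥0) :
    pairAct Y v₁ v₂ μ (fun p => K p + K' p) t = pairAct Y v₁ v₂ μ K t + pairAct Y v₁ v₂ μ K' t := by
  obtain ⟨K₁, C, hK₁, hKK₁, -, hC⟩ := exists_data_of_hasCompactSupport hK hKc
  obtain ⟨K₁', C', hK₁', hKK₁', -, hC'⟩ := exists_data_of_hasCompactSupport hK' hKc'
  obtain ⟨hi, heq⟩ := D.pairAct_eq_integral_prod hv₁ hv₂ μ hK hK₁ hKK₁ hC t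
  obtain ⟨hi', heq'⟩ := D.pairAct_eq_integral_prod hv₁ hv₂ μ hK' hK₁' hKK₁' hC' t
  have hsum : Continuous fun p => K p + K' p := hK.add hK'
  have hsumc : HasCompactSupport fun p => K p + K' p := hKc.add hKc'
  obtain ⟨K₁'', C'', hK₁'', hKK₁'', -, hC''⟩ := exists_data_of_hasCompactSupport hsum hsumc
  obtain ⟨-, heq''⟩ := D.pairAct_eq_integral_prod hv₁ hv₂ μ hsum hK₁'' hKK₁'' hC'' t
  rw [heq, heq', heq'', ← integral_add hi hi']

/-- The pair action is homogeneous in the observable. [folklore] -/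
theorem pairAct_const_mul {K : E × E → ℝ} (hK : Continuous K) (hKc : HasCompactSupport K) (c : ℝ)
    (t : ℝ≥0) : pairAct Y v₁ v₂ μ (fun p => c * K p) t = c * pairAct Y v₁ v₂ μ K t := by
  obtain ⟨K₁, C, hK₁, hKK₁, -, hC⟩ := exists_data_of_hasCompactSupport hK hKc
  obtain ⟨-, heq⟩ := D.pairAct_eq_integral_prod hv₁ hv₂ μ hK hK₁ hKK₁ hC t
  have hs : Continuous fun p => c * K p := continuous_const.mul hK
  have hsc : HasCompactSupport fun p => c * K p := hKc.mul_left
  obtain ⟨K₁', C', hK₁', hKK₁', -, hC'⟩ := exists_data_of_hasCompactSupport hs hsc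
  obtain ⟨-, heq'⟩ := D.pairAct_eq_integral_prod hv₁ hv₂ μ hs hK₁' hKK₁' hC' t
  rw [heq, heq', ← integral_const_mul]

/-- The pair action is subtractive in the observable. [folklore] -/
theorem pairAct_sub {K K' : E × E → ℝ} (hK : Continuous K) (hKc : HasCompactSupport K)
    (hK' : Continuous K') (hKc' : HasCompactSupport K') (t : ℝ≥0) :
    pairAct Y v₁ v₂ μ (fun p => K p - K' p) t = pairAct Y v₁ v₂ μ K t - pairAct Y v₁ v₂ μ K' t := by
  obtain ⟨K₁, C, hK₁, hKK₁, -, hC⟩ := exists_data_of_hasCompactSupport hK hKc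
  obtain ⟨K₁', C', hK₁', hKK₁', -, hC'⟩ := exists_data_of_hasCompactSupport hK' hKc'
  obtain ⟨hi, heq⟩ := D.pairAct_eq_integral_prod hv₁ hv₂ μ hK hK₁ hKK₁ hC t
  obtain ⟨hi', heq'⟩ := D.pairAct_eq_integral_prod hv₁ hv₂ μ hK' hK₁' hKK₁' hC' t
  have hsub : Continuous fun p => K p - K' p := hK.sub hK'
  have hsubc : HasCompactSupport fun p => K p - K' p := hKc.sub hKc'
  obtain ⟨K₁'', C'', hK₁'', hKK₁'', -, hC''⟩ := exists_data_of_hasCompactSupport hsub hsubc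
  obtain ⟨-, heq''⟩ := D.pairAct_eq_integral_prod hv₁ hv₂ μ hsub hK₁'' hKK₁'' hC'' t
  rw [heq, heq', heq'', ← integral_sub hi hi']

/-- **The pair action is continuous in time**: `s ↦ pairAct K s⁺` is continuous on `ℝ` for a
continuous compactly supported `K` (dominated convergence along the continuous solution map, on the
finite part `K₁ × Wiener` of `μ ⊗ Wiener`). [folklore] -/
theorem continuous_pairAct {K : E × E → ℝ} (hK : Continuous K) (hKc : HasCompactSupport K) :
    Continuous fun s : ℝ => pairAct Y v₁ v₂ μ K s.toNNReal := by
  obtain ⟨K₁, C, hK₁, hKK₁, -, hC⟩ := exists_data_of_hasCompactSupport hK hKc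
  have heq : (fun s : ℝ => pairAct Y v₁ v₂ μ K s.toNNReal) = fun s =>
      ∫ p, K (p.1, sdeSolMap Y v₁ v₂ (s.toNNReal : ℝ) p.1 (pairPath p.2)) ∂(μ.prod wienerPair) :=
    funext fun s => (D.pairAct_eq_integral_prod hv₁ hv₂ μ hK hK₁ hKK₁ hC s.toNNReal).2
  rw [heq]
  obtain ⟨hdom, -⟩ := integrable_majorant μ hK₁ C
  refine continuous_of_dominated (fun s => (D.measurable_pair_sdeSolMap hv₁ hv₂ hK _).aestronglyMeasurable)
    (fun s => Eventually.of_forall fun p => norm_pair_sdeSolMap_le hKK₁ hC _ p) hdom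
    (Eventually.of_forall fun p => ?_)
  have hc : Continuous fun s : ℝ => sdeSolMap Y v₁ v₂ (s.toNNReal : ℝ) p.1 (pairPath p.2) :=
    (D.continuous_sdeSolMap hv₁ hv₂ p.1 (pairPath p.2)).comp
      (continuous_subtype_val.comp continuous_real_toNNReal)
  exact hK.comp (continuous_const.prodMk hc)

/-- **A continuous compactly supported pair observable is integrable against `μ ⊗ P_t`.** [folklore] -/
theorem integrable_compProd_pair {K : E × E → ℝ} (hK : Continuous K) (hKc : HasCompactSupport K)
    (t : ℝ≥0) : Integrable K (μ ⊗ₘ sdeKernel Y v₁ v₂ t) := by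
  haveI := D.isMarkovKernel_sdeKernel hv₁ hv₂ t
  obtain ⟨K₁, C, hK₁, hKK₁, -, hC⟩ := exists_data_of_hasCompactSupport hK hKc
  have hfin : (μ ⊗ₘ sdeKernel Y v₁ v₂ t) (K₁ ×ˢ (univ : Set E)) < ⊤ := by
    rw [Measure.compProd_apply_prod hK₁.measurableSet MeasurableSet.univ]
    simp_rw [measure_univ]
    rw [setLIntegral_const, one_mul]
    exact hK₁.measure_lt_top
  have hdom : Integrable ((K₁ ×ˢ (univ : Set E)).indicator fun _ => C) (μ ⊗ₘ sdeKernel Y v₁ v₂ t) :=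
    (integrableOn_const hfin.ne).integrable_indicator (hK₁.measurableSet.prod MeasurableSet.univ)
  refine hdom.mono' hK.aestronglyMeasurable (Eventually.of_forall fun p => ?_)
  by_cases hp : p.1 ∈ K₁
  · rw [indicator_of_mem (show p ∈ K₁ ×ˢ (univ : Set E) from ⟨hp, mem_univ _⟩), Real.norm_eq_abs]
    exact hC _
  · have hnot : p ∉ K₁ ×ˢ (univ : Set E) := fun h => hp h.1
    rw [show p = (p.1, p.2) from rfl, hKK₁ _ hp, norm_zero, indicator_of_notMem hnot]

omit [NormedAddCommGroup E] [NormedSpace ℝ E] [FiniteDimensional ℝ E] [CompleteSpace E] [BorelSpace E]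
  [SecondCountableTopology E] D hv₁ hv₂ in
/-- Integrability of the inner integral of a function integrable against `μ ⊗ κ`. [folklore] -/
theorem integrable_integral_of_integrable_compProd {ν : Measure E} [SFinite ν] {κ : Kernel E E}
    [IsSFiniteKernel κ] {f : E × E → ℝ} (hf : Integrable f (ν ⊗ₘ κ)) :
    Integrable (fun x => ∫ y, f (x, y) ∂(κ x)) ν := by
  have h := hf
  rw [Measure.compProd] at h
  have h2 := MeasureTheory.Integrable.integral_compProd h
  simpa using h2

/-! ### The backward Dynkin identity -/

section Backward

variable {Y' : E → E} (D' : RegularConfinedDrift Y') (hv₁' : v₁ ∈ D'.noise) (hv₂' : v₂ ∈ D'.noise)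
include D' hv₁' hv₂'

omit D hv₁ hv₂ in
/-- The dual inner integrand `g(s, y) = ∫ L₁(x, y) P̂_{s⁺}(y, dx)` is (strongly) measurable in
`(y, s)` (through the solution map: `= E L₁(Ψ_{s⁺}(y, B), y)`). [folklore] -/
theorem stronglyMeasurable_dualInner {L₁ : E × E → ℝ} (hL₁ : Continuous L₁) :
    StronglyMeasurable fun p : E × ℝ => ∫ x, L₁ (x, p.1) ∂(sdeKernel Y' v₁ v₂ p.2.toNNReal p.1) := by
  have heq : (fun p : E × ℝ => ∫ x, L₁ (x, p.1) ∂(sdeKernel Y' v₁ v₂ p.2.toNNReal p.1)) =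
      fun p => ∫ ω, L₁ (sdeSolMap Y' v₁ v₂ (p.2.toNNReal : ℝ) p.1 (pairPath ω), p.1) ∂wienerPair := by
    funext p
    exact D'.integral_sdeKernel hv₁' hv₂' _ _
      ((hL₁.comp (continuous_id.prodMk continuous_const)).aestronglyMeasurable)
  rw [heq]
  have h1 : Measurable fun q : (E × ℝ) × WienerPair =>
      ((q.1.2.toNNReal : ℝ), (q.1.1, pairPath q.2)) :=
    (measurable_coe_nnreal_real.comp (measurable_real_toNNReal.comp (measurable_snd.comp measurable_fst))).prodMk
      ((measurable_fst.comp measurable_fst).prodMk (measurable_pairPath.comp measurable_snd))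
  have h2 := (D'.measurable_uncurry_sdeSolMap hv₁' hv₂').comp h1
  have hm : Measurable fun q : (E × ℝ) × WienerPair =>
      L₁ (sdeSolMap Y' v₁ v₂ (q.1.2.toNNReal : ℝ) q.1.1 (pairPath q.2), q.1.1) :=
    hL₁.measurable.comp (h2.prodMk (measurable_fst.comp measurable_fst))
  exact hm.stronglyMeasurable.integral_prod_right'

omit [FiniteDimensional ℝ E] [SecondCountableTopology E] D D' hv₁ hv₂ hv₁' hv₂' in
/-- A bound of the dual inner integrand: `‖∫ L₁(x, y) P̂(y, dx)‖ₑ ≤ C · P̂(y, K₁)`. [folklore] -/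
theorem enorm_dualInner_le {L₁ : E × E → ℝ} {K₁ : Set E} (hK₁ : IsCompact K₁)
    (hLK₁ : ∀ x, x ∉ K₁ → ∀ y, L₁ (x, y) = 0) {C : ℝ} (hC : ∀ p, |L₁ p| ≤ C) (s : ℝ≥0) (y : E) :
    ‖∫ x, L₁ (x, y) ∂(sdeKernel Y' v₁ v₂ s y)‖ₑ ≤ ENNReal.ofReal C * sdeKernel Y' v₁ v₂ s y K₁ := by
  refine (enorm_integral_le_lintegral_enorm _).trans ?_
  have hpt : ∀ x, ‖L₁ (x, y)‖ₑ ≤ K₁.indicator (fun _ => ENNReal.ofReal C) x := by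
    intro x
    by_cases hx : x ∈ K₁
    · rw [indicator_of_mem hx, Real.enorm_eq_ofReal_abs]
      exact ENNReal.ofReal_le_ofReal (hC _)
    · rw [hLK₁ x hx y, enorm_zero]
      exact zero_le
  refine (lintegral_mono hpt).trans ?_
  rw [lintegral_indicator_const hK₁.measurableSet]

/-- **The backward Dynkin identity for pair observables.** For `Y' = -Y` a regular confined drift,
`tr DY ≡ d`, `H ∈ C²_c(E × E)` and `t > 0`:
`pairAct H t = e^{-dt} (∫ H(x, x) μ(dx) + ∫₀ᵗ e^{ds} pairAct (L̂₁ H) s ds)` — duality at time `t`,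
Dynkin's identity for the reversed kernels in the first variable, Fubini, and duality back at
each time `s`. [folklore] -/
theorem pairAct_eq_of_contDiff (hY' : ∀ y, Y' y = -Y y) {d : ℝ}
    (hdiv : ∀ y, LinearMap.trace ℝ E (fderiv ℝ Y y : E →ₗ[ℝ] E) = d) {H : E × E → ℝ}
    (hH : ContDiff ℝ 2 H) (hHc : HasCompactSupport H) {t : ℝ≥0} (ht : 0 < t) :
    pairAct Y v₁ v₂ μ H t =
      Real.exp (-(d * t)) * ((∫ x, H (x, x) ∂μ) +
        ∫ s in (0 : ℝ)..t, Real.exp (d * s) *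
          pairAct Y v₁ v₂ μ (sdeGeneratorFst Y' v₁ v₂ H) s.toNNReal) := by
  haveI := D'.isMarkovKernel_sdeKernel hv₁' hv₂' t
  have hY'c : Continuous Y' := D'.contDiff_drift.continuous
  set L₁ : E × E → ℝ := sdeGeneratorFst Y' v₁ v₂ H with hL₁_def
  have hL₁c : Continuous L₁ := continuous_sdeGeneratorFst hY'c hH
  have hL₁s : HasCompactSupport L₁ := hasCompactSupport_sdeGeneratorFst hHc
  obtain ⟨K₁, C, hK₁, hLK₁, hC0, hC⟩ := exists_data_of_hasCompactSupport hL₁c hL₁s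
  have hHcont : Continuous H := hH.continuous
  -- Step 1: duality at time `t`
  obtain ⟨hswap, hdual⟩ := D.integral_sdeKernel_duality D'.toConfinedDrift hv₁ hv₂ hv₁' hv₂' μ hY' hdiv ht
    (D.integrable_compProd_pair hv₁ hv₂ μ hHcont hHc t)
  rw [pairAct_def, hdual]
  congr 1
  -- Step 2: Dynkin for the reversed kernels, in the first variable
  set g : ℝ → E → ℝ := fun s y => ∫ x, L₁ (x, y) ∂(sdeKernel Y' v₁ v₂ s.toNNReal y) with hg_def
  have hdyn : ∀ y, ∫ x, H (x, y) ∂(sdeKernel Y' v₁ v₂ t y) = H (y, y) + ∫ s in (0 : ℝ)..t, g s y := by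
    intro y
    have h := D'.sdeKernel_dynkin hv₁' hv₂' (contDiff_fstSlice hH y) (hasCompactSupport_fstSlice hHc y) t y
    rw [sub_eq_iff_eq_add'] at h
    rw [h]
    rfl
  -- integrability over `μ(dy)`
  have hI1 : Integrable (fun y => ∫ x, H (x, y) ∂(sdeKernel Y' v₁ v₂ t y)) μ :=
    integrable_integral_of_integrable_compProd hswap
  have hI2 : Integrable (fun y => H (y, y)) μ :=
    (hHcont.comp (continuous_id.prodMk continuous_id)).integrable_of_hasCompactSupport (hasCompactSupport_diag hHc)
  have hI3 : Integrable (fun y => ∫ s in (0 : ℝ)..t, g s y) μ := by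
    have h : (fun y => ∫ s in (0 : ℝ)..t, g s y) = fun y =>
        (∫ x, H (x, y) ∂(sdeKernel Y' v₁ v₂ t y)) - H (y, y) := funext fun y => by rw [hdyn y]; ring
    rw [h]
    exact hI1.sub hI2
  have hstep2 : ∫ y, ∫ x, H (x, y) ∂(sdeKernel Y' v₁ v₂ t y) ∂μ =
      (∫ y, H (y, y) ∂μ) + ∫ y, (∫ s in (0 : ℝ)..t, g s y) ∂μ := by
    rw [← integral_add hI2 hI3]
    exact integral_congr_ae (Eventually.of_forall hdyn)
  rw [hstep2]
  congr 1
  -- Step 3: Fubini in `(y, s)` on `E × (0, t]`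
  set ν : Measure ℝ := volume.restrict (Ioc (0 : ℝ) t) with hν
  haveI : IsFiniteMeasure ν := by
    rw [hν]
    exact ⟨by rw [Measure.restrict_apply_univ, Real.volume_Ioc]; exact ENNReal.ofReal_lt_top⟩
  have hmeas : StronglyMeasurable fun p : E × ℝ => g p.2 p.1 :=
    stronglyMeasurable_dualInner D' hv₁' hv₂' hL₁c
  have hfin : HasFiniteIntegral (fun p : E × ℝ => g p.2 p.1) (μ.prod ν) := by
    -- `‖g s y‖ ≤ C P̂_{s⁺}(y, K₁)` and `∫ P̂_{s⁺}(y, K₁) μ(dy) = e^{d s} μ(K₁) ≤ e^{|d| t} μ(K₁)`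
    have hbd : ∀ p : E × ℝ, ‖g p.2 p.1‖ₑ ≤
        ENNReal.ofReal C * sdeKernel Y' v₁ v₂ p.2.toNNReal p.1 K₁ := fun p =>
      enorm_dualInner_le hK₁ hLK₁ hC _ _
    have hmk : Measurable fun p : E × ℝ => sdeKernel Y' v₁ v₂ p.2.toNNReal p.1 K₁ := by
      -- through the solution map (a `lintegral` of a jointly measurable function)
      have heq : (fun p : E × ℝ => sdeKernel Y' v₁ v₂ p.2.toNNReal p.1 K₁) = fun p =>
          ∫⁻ ω, K₁.indicator (1 : E → ℝ≥0∞) (sdeSolMap Y' v₁ v₂ (p.2.toNNReal : ℝ) p.1 (pairPath ω))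
            ∂wienerPair := by
        funext p
        rw [← lintegral_indicator_one hK₁.measurableSet,
          D'.lintegral_sdeKernel hv₁' hv₂' _ _ (measurable_one.indicator hK₁.measurableSet)]
      rw [heq]
      have h1 : Measurable fun q : (E × ℝ) × WienerPair => ((q.1.2.toNNReal : ℝ), (q.1.1, pairPath q.2)) :=
        (measurable_coe_nnreal_real.comp (measurable_real_toNNReal.comp (measurable_snd.comp measurable_fst))).prodMk
          ((measurable_fst.comp measurable_fst).prodMk (measurable_pairPath.comp measurable_snd))
      have h2 := (D'.measurable_uncurry_sdeSolMap hv₁' hv₂').comp h1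
      exact ((measurable_one.indicator hK₁.measurableSet).comp h2).lintegral_prod_right'
    set B : ℝ≥0∞ := ENNReal.ofReal (Real.exp (|d| * t)) * μ K₁ with hB
    have hBfin : B < ⊤ := ENNReal.mul_lt_top ENNReal.ofReal_lt_top hK₁.measure_lt_top
    have hslice : ∀ s ∈ Ioc (0 : ℝ) t, ∫⁻ y, sdeKernel Y' v₁ v₂ s.toNNReal y K₁ ∂μ ≤ B := by
      intro s hs
      have hs0 : 0 < s.toNNReal := Real.toNNReal_pos.2 hs.1
      rw [D.lintegral_sdeKernel_rev_apply D'.toConfinedDrift hv₁ hv₂ hv₁' hv₂' μ hY' hdiv hs0 hK₁.measurableSet,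
        Real.coe_toNNReal _ hs.1.le, hB]
      refine mul_le_mul' (ENNReal.ofReal_le_ofReal (Real.exp_le_exp.2 ?_)) le_rfl
      calc d * s ≤ |d| * s := mul_le_mul_of_nonneg_right (le_abs_self d) hs.1.le
        _ ≤ |d| * t := mul_le_mul_of_nonneg_left hs.2 (abs_nonneg d)
    calc ∫⁻ p, ‖g p.2 p.1‖ₑ ∂(μ.prod ν)
        ≤ ∫⁻ p, ENNReal.ofReal C * sdeKernel Y' v₁ v₂ p.2.toNNReal p.1 K₁ ∂(μ.prod ν) := lintegral_mono hbd
      _ = ∫⁻ s, ∫⁻ y, ENNReal.ofReal C * sdeKernel Y' v₁ v₂ s.toNNReal y K₁ ∂μ ∂ν :=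
          lintegral_prod_symm _ (hmk.const_mul _).aemeasurable
      _ ≤ ∫⁻ _s, ENNReal.ofReal C * B ∂ν := by
          refine lintegral_mono_ae ?_
          rw [hν, ae_restrict_iff' measurableSet_Ioc]
          refine Eventually.of_forall fun s hs => ?_
          rw [lintegral_const_mul _ ((sdeKernel Y' v₁ v₂ s.toNNReal).measurable_coe hK₁.measurableSet)]
          exact mul_le_mul' le_rfl (hslice s hs)
      _ < ⊤ := by
          rw [lintegral_const]
          exact ENNReal.mul_lt_top (ENNReal.mul_lt_top ENNReal.ofReal_lt_top hBfin) (measure_lt_top _ _)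
  have hint : Integrable (uncurry fun y s => g s y) (μ.prod ν) := ⟨hmeas.aestronglyMeasurable, hfin⟩
  have hstep3 : ∫ y, (∫ s in (0 : ℝ)..t, g s y) ∂μ = ∫ s in (0 : ℝ)..t, ∫ y, g s y ∂μ := by
    rw [intervalIntegral.integral_of_le t.coe_nonneg]
    simp_rw [intervalIntegral.integral_of_le t.coe_nonneg]
    exact integral_integral_swap hint
  rw [hstep3]
  -- Step 4: duality back at each `s ∈ (0, t]`
  refine intervalIntegral.integral_congr_ae (Eventually.of_forall fun s hs => ?_)
  rw [uIoc_of_le t.coe_nonneg] at hs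
  have hs0 : 0 < s.toNNReal := Real.toNNReal_pos.2 hs.1
  obtain ⟨-, hdual_s⟩ := D.integral_sdeKernel_duality D'.toConfinedDrift hv₁ hv₂ hv₁' hv₂' μ hY' hdiv hs0
    (D.integrable_compProd_pair hv₁ hv₂ μ hL₁c hL₁s s.toNNReal)
  rw [pairAct_def, hdual_s, Real.coe_toNNReal _ hs.1.le, ← mul_assoc, ← Real.exp_add,
    show d * s + -(d * s) = 0 by ring, Real.exp_zero, one_mul]

/-- **The backward equation for pair observables**: for `H ∈ C²_c(E × E)` and `t > 0`,
`d/dt pairAct H t = -d · pairAct H t + pairAct (L̂₁ H) t = pairAct (Lᵀ₁ H) t`. [folklore] -/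
theorem hasDerivAt_pairAct (hY' : ∀ y, Y' y = -Y y) {d : ℝ}
    (hdiv : ∀ y, LinearMap.trace ℝ E (fderiv ℝ Y y : E →ₗ[ℝ] E) = d) {H : E × E → ℝ}
    (hH : ContDiff ℝ 2 H) (hHc : HasCompactSupport H) {t : ℝ} (ht : 0 < t) :
    HasDerivAt (fun s : ℝ => pairAct Y v₁ v₂ μ H s.toNNReal)
      (-d * pairAct Y v₁ v₂ μ H t.toNNReal +
        pairAct Y v₁ v₂ μ (sdeGeneratorFst Y' v₁ v₂ H) t.toNNReal) t := by
  have hY'c : Continuous Y' := D'.contDiff_drift.continuous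
  set L₁ : E × E → ℝ := sdeGeneratorFst Y' v₁ v₂ H with hL₁_def
  have hL₁c : Continuous L₁ := continuous_sdeGeneratorFst hY'c hH
  have hL₁s : HasCompactSupport L₁ := hasCompactSupport_sdeGeneratorFst hHc
  set A : ℝ := ∫ x, H (x, x) ∂μ with hA
  set q : ℝ → ℝ := fun s => Real.exp (d * s) * pairAct Y v₁ v₂ μ L₁ s.toNNReal with hq
  have hqc : Continuous q :=
    (Real.continuous_exp.comp (continuous_const.mul continuous_id)).mul
      (D.continuous_pairAct hv₁ hv₂ μ hL₁c hL₁s)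
  set Iq : ℝ → ℝ := fun s => ∫ r in (0 : ℝ)..s, q r with hIq
  have hIq' : ∀ s, HasDerivAt Iq (q s) s := fun s =>
    intervalIntegral.integral_hasDerivAt_right (hqc.intervalIntegrable _ _)
      (hqc.stronglyMeasurableAtFilter _ _) hqc.continuousAt
  set G : ℝ → ℝ := fun s => Real.exp (-(d * s)) * (A + Iq s) with hG
  have hexp : ∀ s, HasDerivAt (fun s : ℝ => Real.exp (-(d * s))) (Real.exp (-(d * s)) * -d) s := by
    intro s
    have h1 : HasDerivAt (fun s : ℝ => -(d * s)) (-d) s := by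
      have h := (hasDerivAt_id' s).const_mul (-d)
      simp only [mul_one] at h
      exact h.congr_of_eventuallyEq (Eventually.of_forall fun x => (neg_mul d x).symm)
    exact h1.exp
  have hG' : HasDerivAt G (Real.exp (-(d * t)) * -d * (A + Iq t) + Real.exp (-(d * t)) * q t) t :=
    (hexp t).mul ((hIq' t).const_add A)
  -- `G = pairAct H ·⁺` near `t`
  have hGeq : (fun s : ℝ => pairAct Y v₁ v₂ μ H s.toNNReal) =ᶠ[𝓝 t] G := by
    filter_upwards [Ioi_mem_nhds ht] with s hs
    have hs0 : 0 < s.toNNReal := Real.toNNReal_pos.2 hs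
    have h := D.pairAct_eq_of_contDiff hv₁ hv₂ μ D' hv₁' hv₂' hY' hdiv hH hHc hs0
    rw [Real.coe_toNNReal _ (le_of_lt hs)] at h
    exact h
  refine (hG'.congr_of_eventuallyEq hGeq |>.congr_deriv ?_)
  have hval : pairAct Y v₁ v₂ μ H t.toNNReal = Real.exp (-(d * t)) * (A + Iq t) := by
    have h := hGeq.self_of_nhds
    exact h
  rw [hval, hq]
  simp only
  rw [show Real.exp (-(d * t)) * (Real.exp (d * t) * pairAct Y v₁ v₂ μ L₁ t.toNNReal) =
      (Real.exp (-(d * t)) * Real.exp (d * t)) * pairAct Y v₁ v₂ μ L₁ t.toNNReal by ring,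
    ← Real.exp_add, show -(d * t) + d * t = 0 by ring, Real.exp_zero, one_mul]
  ring

end Backward

end ConfinedDrift

end Literature.MathematicalPhysics.KineticTheory
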